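import Summits.CriticalPhenomena.CardyFormulaZ2.Theorems.CardyUniqueLimitCardyRigidityFaceHalfPlaneG2OfTransfer
import Literature.Probability.RandomPlanarGeometry.LoewnerDelayedDriver
import Literature.Probability.RandomPlanarGeometry.LoewnerBoundaryExtension
import Literature.Probability.RandomPlanarGeometry.SLETraceCriterionProofs
import Literature.Probability.RandomPlanarGeometry.ChordalCurveFamilyProofs
import Literature.Probability.LatticeModels.FKInterfaceDrivingLocality
import HarnessLib

/-!
# The capacity-`u` head past is local in the trace (input (T2) of `PercFaceAnnulusTransfer`, Loewner side)

Crux `Summit.CriticalPhenomena.CardyFormulaZ2.Theses.CardyUniqueLimit.CardyRigidity`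
(stmt-CriticalPhenomena-0746), line `crossing_martingale`, stub A2‴ `stub_percFaceAnnulusTransfer :
Driver.PercFaceAnnulusTransfer` (`…FaceHalfPlaneG2OfTransfer.lean`), input (T2) "the continuum past
`stopAt F (headClass γ̂ u)` of the capacity-`u` truncation is a function of the discrete past".  The
lattice half (prefix events, revealed edges) is the tree's `FKExplorationDomainMarkov.lean`; the
locality of the DRIVING FUNCTION in an initial piece of the curve is the tree's
`LoewnerTransformLocality.lean`.  This file supplies the three remaining Loewner-side facts:

* `Head.isLoewnerDescribed_of_drivingFunction_eq` — **the Loewner pair of the predicate describes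
  the interface**: from `p ∈ generatedPairs`, `Y = compactifiedClass Φ b γ̂` and
  `drivingFunction φ Y = W` (the a.s. structure handed over by box tightness) follows
  `IsLoewnerDescribed φ Y W` — if `Y` were not describable its Loewner transform would be the junk
  `0`, so `W = 0` and `γ̂` is the vertical line `2i√t` (Rohde–Schramm Thm. 4.1 for the zero driver,
  `invFunOn_map_zero_driving`), which is transient, and `⟦Φ ∘ γ̂⟧` is then described by `0`
  (`isLoewnerDescribed_compactifiedClass`);
* `Head.trace_eqOn_of_eqOn` — **locality of the trace**: generating curves of two continuous
  driving functions equal on `[0, T]` agree on `[0, T]` (`γ(t) = f̄_t(W_t)` and `f_t = g_t⁻¹` is local,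
  `Loewner.map_eq_map_of_eqOn`);
* `Head.stopAt_headClass_eq_of_eqOn` — **locality of the stopped head**: if two paths agree on
  `[0, T]` and `T` covers the past of the first one (`u ≤ T`, or `F` is met by time `T`), then
  `stopAt F (headClass · u)` agree (first hitting parameters through `CurveClass.stopAt_mk_holds`).

References: G. F. Lawler, *Conformally Invariant Processes in the Plane* (2005), §4.1, Prop. 4.31,
Ex. 4.11 [Lawler2005]; S. Rohde, O. Schramm, Ann. of Math. 161 (2005), Thm. 4.1 [RohdeSchramm2005];
A. Kemppainen, S. Smirnov, Ann. Probab. 45 (2017), §1.2, §4.2 [KemppainenSmirnov2017].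
(buildfix 2026-08-20: comment-only re-land to re-enqueue the module build after its blocking imports were repaired; no declaration changed.)
-/

noncomputable section

open MeasureTheory Filter Set Topology Metric Complex
open scoped NNReal unitInterval
open UpperHalfPlane (upperHalfPlaneSet)
open Literature.Probability Literature.Probability.RandomPlanarGeometry

namespace Summit.CriticalPhenomena.CardyFormulaZ2.Cruxes.CardyRigidity.CrossingMartingale

namespace Head

/-! ### The zero driver: its trace is the transient vertical line -/

/-- **The chain of the zero driving function is generated by the vertical line `t ↦ 2i√t`**
(Lawler Ex. 4.11, `g_t(z) = √(z² + 4t)`; through Rohde–Schramm's Thm. 4.1 and the tree's explicit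
backward flow `invFunOn_map_zero_driving`). [cite: Lawler2005, Ex. 4.11] -/
theorem isGeneratedByCurve_zero_driving :
    Loewner.IsGeneratedByCurve (fun _ : ℝ≥0 ↦ (0 : ℝ)) (fun t : ℝ≥0 ↦ Complex.I * Real.sqrt (4 * t)) := by
  refine Loewner.isGeneratedByCurve_of_thm41 RohdeSchramm2005_thm41_holds continuous_const ?_
    fun t ↦ ?_
  · exact continuous_const.mul (Complex.continuous_ofReal.comp
      (Real.continuous_sqrt.comp (continuous_const.mul NNReal.continuous_coe)))
  · have hc : Tendsto (fun y : ℝ ↦ Complex.I * (Real.sqrt (y ^ 2 + 4 * t) : ℂ)) (𝓝[>] 0)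
        (𝓝 (Complex.I * (Real.sqrt (0 ^ 2 + 4 * t) : ℂ))) :=
      ((continuous_const.mul (Complex.continuous_ofReal.comp (Real.continuous_sqrt.comp
        ((continuous_pow 2).add continuous_const)))).tendsto 0).mono_left nhdsWithin_le_nhds
    have h0 : Complex.I * (Real.sqrt (0 ^ 2 + 4 * t) : ℂ) = Complex.I * Real.sqrt (4 * t) := by simp
    rw [h0] at hc
    refine hc.congr' ?_
    filter_upwards [self_mem_nhdsWithin] with y hy
    rw [Complex.ofReal_zero, zero_add]
    exact (Loewner.invFunOn_map_zero_driving t hy).symm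

/-- A Loewner pair with zero driving function has the transient curve `2i√t`.
[cite: Lawler2005, Ex. 4.11] -/
theorem tendsto_norm_of_driving_eq_zero {p : C(ℝ≥0, ℂ) × C(ℝ≥0, ℝ)} (hp : p ∈ generatedPairs)
    (h0 : ⇑p.2 = fun _ ↦ 0) : Tendsto (fun t ↦ ‖p.1 t‖) atTop atTop := by
  have hgen : Loewner.IsGeneratedByCurve (fun _ : ℝ≥0 ↦ (0 : ℝ)) p.1 := by
    have h := (mem_generatedPairs.1 hp)
    rwa [h0] at h
  have heq : ⇑p.1 = fun t : ℝ≥0 ↦ Complex.I * Real.sqrt (4 * t) :=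
    Loewner.IsGeneratedByCurve.unique_holds continuous_const hgen isGeneratedByCurve_zero_driving
  have hnorm : ∀ t : ℝ≥0, ‖p.1 t‖ = Real.sqrt (4 * t) := fun t ↦ by
    rw [heq, norm_mul, Complex.norm_I, one_mul, Complex.norm_real,
      Real.norm_of_nonneg (Real.sqrt_nonneg _)]
  simp_rw [hnorm]
  refine tendsto_atTop_atTop.2 fun b ↦ ⟨⟨max b 0 ^ 2, by positivity⟩, fun t ht ↦ ?_⟩
  have ht' : (max b 0) ^ 2 ≤ (t : ℝ) := ht
  calc b ≤ max b 0 := le_max_left _ _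
    _ = Real.sqrt ((max b 0) ^ 2) := (Real.sqrt_sq (le_max_right _ _)).symm
    _ ≤ Real.sqrt (4 * t) := Real.sqrt_le_sqrt (by linarith)

/-- **The Loewner pair of the predicate describes the interface.**  For a chordal map `φ` of
`(D; a, b)`, a pair `p ∈ generatedPairs` and a curve class `Y = ⟦Φ ∘ γ̂⟧` (`compactifiedClass`)
whose Loewner transform is `drivingFunction φ Y = W`: `Y` is described through `φ` by `W`.
[cite: KemppainenSmirnov2017, §1.2] -/
theorem isLoewnerDescribed_of_drivingFunction_eq {D : DobrushinDomain}
    {φ : ConformalEquiv upperHalfPlaneSet D.carrier} (hφ : D.IsChordalUniformizing φ)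
    {p : C(ℝ≥0, ℂ) × C(ℝ≥0, ℝ)} (hp : p ∈ generatedPairs) {Y : CurveClass ℂ}
    (hY : Y = compactifiedClass φ.boundaryExtension (D.pt 1) p.1)
    (hW : drivingFunction φ Y = p.2) : IsLoewnerDescribed φ Y p.2 := by
  by_cases h : IsLoewnerDescribable φ Y
  · rw [← hW]; exact isLoewnerDescribed_drivingFunction h
  · have h0 : ⇑p.2 = fun _ ↦ 0 := by
      rw [← hW, drivingFunction_of_not h]; rfl
    rw [hY]
    exact isLoewnerDescribed_compactifiedClass hφ hp (tendsto_norm_of_driving_eq_zero hp h0)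

/-! ### Locality of the trace -/

/-- **Locality of the trace**: the generating curves of two continuous driving functions equal on
`[0, T]` agree on `[0, T]` (`γ(t) = f̄_t(W_t)`, and the backward map `f_t` depends on `W|[0, t]`
only). [cite: Lawler2005, §4.1 and Prop. 4.31] -/
theorem trace_eqOn_of_eqOn {W W' : ℝ≥0 → ℝ} {γ γ' : ℝ≥0 → ℂ} (hW : Continuous W)
    (hW' : Continuous W') (hγ : Loewner.IsGeneratedByCurve W γ) (hγ' : Loewner.IsGeneratedByCurve W' γ')
    {T : ℝ≥0} (h : ∀ s : ℝ≥0, s ≤ T → W s = W' s) {t : ℝ≥0} (ht : t ≤ T) : γ t = γ' t := by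
  have ht' : ∀ s : ℝ≥0, s ≤ t → W s = W' s := fun s hs ↦ h s (hs.trans ht)
  -- the backward maps agree on `ℍ`
  have hinv : ∀ w ∈ upperHalfPlaneSet, Loewner.loewnerInv W t w = Loewner.loewnerInv W' t w := by
    intro w hw
    have h1 : Loewner.loewnerInv W t w ∈ Loewner.domain W t :=
      (Loewner.bijOn_invFunOn_map hW t).mapsTo hw
    have h2 : Loewner.loewnerInv W' t w ∈ Loewner.domain W t := by
      rw [Loewner.domain_eq_domain_of_eqOn hW hW' ht']
      exact (Loewner.bijOn_invFunOn_map hW' t).mapsTo hw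
    have e1 : Loewner.map W t (Loewner.loewnerInv W t w) = w :=
      (Loewner.bijOn_map hW t).invOn_invFunOn.2 hw
    have e2 : Loewner.map W' t (Loewner.loewnerInv W' t w) = w :=
      (Loewner.bijOn_map hW' t).invOn_invFunOn.2 hw
    have e3 : Loewner.map W' t (Loewner.loewnerInv W' t w) = Loewner.map W t (Loewner.loewnerInv W' t w) :=
      Loewner.map_eq_map_of_eqOn hW hW' ht' h2
    exact (Loewner.bijOn_map hW t).injOn h1 h2 (by rw [e1, ← e3, e2])
  -- hence so do their boundary extensions at the (common) driving point
  have hz : 0 ≤ ((W t : ℝ) : ℂ).im := by simp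
  haveI := Loewner.neBot_nhdsWithin_ofReal (W t)
  have h1 := hγ.tendsto_bdryInv hW t hz
  have h2 := hγ'.tendsto_bdryInv hW' t hz
  have h2' : Tendsto (Loewner.loewnerInv W t) (𝓝[upperHalfPlaneSet] ((W t : ℝ) : ℂ))
      (𝓝 (Loewner.bdryInv W' t (W t))) :=
    h2.congr' (by filter_upwards [self_mem_nhdsWithin] with w hw using (hinv w hw).symm)
  rw [← hγ.bdryInv_driving hW t, ← hγ'.bdryInv_driving hW' t, ← ht' t le_rfl]
  exact tendsto_nhds_unique h1 h2'

/-- The same for Loewner pairs. [cite: Lawler2005, §4.1 and Prop. 4.31] -/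
theorem fst_eqOn_of_snd_eqOn {p p' : C(ℝ≥0, ℂ) × C(ℝ≥0, ℝ)} (hp : p ∈ generatedPairs)
    (hp' : p' ∈ generatedPairs) {T : ℝ≥0} (h : EqOn p.2 p'.2 (Icc 0 T)) : EqOn p.1 p'.1 (Icc 0 T) :=
  fun _ ht ↦ trace_eqOn_of_eqOn p.2.continuous p'.2.continuous hp hp'
    (fun _ hs ↦ h ⟨zero_le, hs⟩) ht.2

/-! ### Locality of the stopped head -/

variable {E : Type*} [MetricSpace E]

/-- Curves agreeing up to a parameter `r₀` beyond which the first has met the closed set `F`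
(or `r₀ = 1`) have the same first hitting parameter. [folklore] -/
theorem hitParam_eq_of_eqOn {F : Set E} {c c' : Curve E} {r₀ : ℝ} (hr₀ : c.hitParam F ≤ r₀)
    (heq : ∀ s : I, (s : ℝ) ≤ r₀ → c s = c' s) (hF : IsClosed F) : c.hitParam F = c'.hitParam F := by
  have hmem := Curve.hitParam_mem_hitSet hF c
  apply le_antisymm
  · -- no earlier hit of `c'`
    by_contra hlt
    push Not at hlt
    have hmem' := Curve.hitParam_mem_hitSet hF c'
    rcases hmem' with ⟨hI, hF'⟩ | h1
    · have hs : ((⟨c'.hitParam F, hI⟩ : I) : ℝ) ≤ r₀ := (hlt.le.trans hr₀)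
      rw [← heq _ hs] at hF'
      exact absurd (Curve.hitParam_le hF') (not_le.2 hlt)
    · have := (c.hitParam_mem_Icc F).2
      rw [mem_singleton_iff.1 h1] at hlt
      exact absurd this (not_le.2 hlt)
  · rcases hmem with ⟨hI, hFc⟩ | h1
    · rw [heq _ hr₀] at hFc
      exact Curve.hitParam_le hFc
    · rw [mem_singleton_iff.1 h1]
      exact (c'.hitParam_mem_Icc F).2

/-- Curves agreeing up to a parameter `r₀` beyond the first hitting parameter of the first one have
the same initial segment up to the closed set `F`. [folklore] -/
theorem stopAt_eq_of_eqOn {F : Set E} {c c' : Curve E} {r₀ : ℝ} (hr₀ : c.hitParam F ≤ r₀)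
    (heq : ∀ s : I, (s : ℝ) ≤ r₀ → c s = c' s) (hF : IsClosed F) : c.stopAt F = c'.stopAt F := by
  have hh := hitParam_eq_of_eqOn hr₀ heq hF
  refine Curve.ext (ContinuousMap.ext fun s ↦ ?_)
  show c.stopAt F s = c'.stopAt F s
  rw [Curve.stopAt_apply, Curve.stopAt_apply, ← hh]
  refine heq _ (max_le ((c.hitParam_mem_Icc F).1.trans hr₀) ((min_le_right _ _).trans ?_))
  exact (mul_le_of_le_one_right (c.hitParam_mem_Icc F).1 s.2.2).trans hr₀

/-- **Locality of the stopped head.**  If two paths `γ, γ' : [0, ∞) → ℂ` agree on `[0, T]` and `T`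
covers the past of the capacity-`u` head of `γ` up to the closed set `F` (`u ≤ T`, or `γ` meets `F`
by time `T`), then the heads stopped at `F` coincide:
`stopAt F (headClass γ u) = stopAt F (headClass γ' u)`. [cite: KemppainenSmirnov2017, §4.2] -/
theorem stopAt_headClass_eq_of_eqOn {γ γ' : C(ℝ≥0, ℂ)} {u T : ℝ≥0} (hu : 0 < u) {F : Set ℂ}
    (hF : IsClosed F) (heq : EqOn γ γ' (Icc 0 T)) (hcov : u ≤ T ∨ ∃ t ≤ T, γ t ∈ F) :
    CurveClass.stopAt F (Driver.headClass γ u) = CurveClass.stopAt F (Driver.headClass γ' u) := by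
  unfold Driver.headClass
  rw [CurveClass.stopAt_mk_holds F hF, CurveClass.stopAt_mk_holds F hF]
  congr 1
  have hu0 : (0 : ℝ) < u := hu
  refine stopAt_eq_of_eqOn (r₀ := T / u) ?_ (fun s hs ↦ ?_) hF
  · -- the hitting parameter of the head is at most `T / u`
    rcases hcov with hle | ⟨t, htT, htF⟩
    · exact (Curve.hitParam_mem_Icc F _).2.trans ((one_le_div hu0).2 (by exact_mod_cast hle))
    · rcases le_or_gt t u with htu | hut
      · have hs1 : ((t / u : ℝ≥0) : ℝ) ≤ 1 := by
          have : t / u ≤ 1 := div_le_one_of_le₀ htu zero_le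
          exact_mod_cast this
        set s₀ : I := ⟨((t / u : ℝ≥0) : ℝ), NNReal.coe_nonneg _, hs1⟩ with hs₀
        have hmem : (⟨γ.comp ⟨fun t : I ↦ u * Real.toNNReal (t : ℝ),
            continuous_const.mul (continuous_real_toNNReal.comp continuous_subtype_val)⟩⟩ :
              Curve ℂ) s₀ ∈ F := by
          change γ (u * Real.toNNReal ((t / u : ℝ≥0) : ℝ)) ∈ F
          rwa [Real.toNNReal_coe, mul_div_cancel₀ _ hu.ne']
        refine (Curve.hitParam_le hmem).trans ?_
        change ((t / u : ℝ≥0) : ℝ) ≤ T / u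
        rw [NNReal.coe_div]
        exact div_le_div_of_nonneg_right (by exact_mod_cast htT) hu0.le
      · have h1 : (1 : ℝ) ≤ T / u := by
          rw [one_le_div hu0]
          exact_mod_cast (hut.le.trans htT)
        exact (Curve.hitParam_mem_Icc F _).2.trans h1
  · -- on `[0, T / u]` the heads agree
    change γ (u * Real.toNNReal (s : ℝ)) = γ' (u * Real.toNNReal (s : ℝ))
    refine heq ⟨zero_le, ?_⟩
    have h1 : Real.toNNReal (s : ℝ) ≤ Real.toNNReal (T / u) := Real.toNNReal_le_toNNReal hs
    calc u * Real.toNNReal (s : ℝ) ≤ u * Real.toNNReal (T / u) := mul_le_mul_right h1 u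
      _ = T := by
        rw [show ((T : ℝ) / u) = ((T / u : ℝ≥0) : ℝ) by push_cast; ring, Real.toNNReal_coe,
          mul_div_cancel₀ _ hu.ne']

/-! ### The stopped head is a class function of the exploration prefix -/

open Literature.Probability.LatticeModels Literature.Probability.LatticeModels.DiscreteDobrushin
  Literature.Probability.Percolation in
/-- **The stopped head is a class function of the exploration prefix** (input (T2) of
`Driver.PercFaceAnnulusTransfer` at one scale, for the native orientation of the interface).  Let
the exploration polylines of `ω` and `ω'` be described through the chordal map `φ'` of `(D'; a', b')`
by the Loewner pairs `p`, `p'`, and let `ω'` lie in the prefix event `C_n(ω)`.  If `T` is a time whose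
trace segment `Φ'(γ̂[0, T])` lies in the explored piece `γ_ω[0, n+1]` and which covers the past of
the capacity-`u` head of `γ̂ = p.1` up to the closed set `F` (`u ≤ T` or `γ̂` meets `F` by time `T`),
then the stopped heads agree: the driving functions agree on `[0, T]` (locality of the Loewner
transform, `IsLoewnerDescribed.eqOn_of_eqOn`), hence so do the traces and the stopped heads.
[cite: KemppainenSmirnov2017, §4.2] [cite: DuminilCopinSmirnov2012Clay, Prop. 6.7 (proof, p. 29)] -/
theorem stopAt_headClass_eq_of_mem_explorationCylinder {E : DiscreteDobrushin}
    {hE : E.IsZdAdmissible} {D' : DobrushinDomain}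
    {φ' : ConformalEquiv upperHalfPlaneSet D'.carrier} (hφ' : D'.IsChordalUniformizing φ')
    {ω ω' : BondConfig (Site 2)} {n : ℕ} (hω' : ω' ∈ explorationCylinder hE ω n)
    {p p' : C(ℝ≥0, ℂ) × C(ℝ≥0, ℝ)} (hp : p ∈ generatedPairs) (hp' : p' ∈ generatedPairs)
    (hd : IsLoewnerDescribed φ'
      (CurveClass.mk ⟨polyline ((medialExploration E ω).map (medialPoint E.δ))⟩) p.2)
    (hd' : IsLoewnerDescribed φ'
      (CurveClass.mk ⟨polyline ((medialExploration E ω').map (medialPoint E.δ))⟩) p'.2)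
    {T : ℝ≥0} (hT : φ'.boundaryExtension '' (p.1 '' Icc 0 T) ⊆
      range (polyline ((explorationPrefix E n ω).map (medialPoint E.δ))))
    {u : ℝ≥0} (hu : 0 < u) {F : Set ℂ} (hF : IsClosed F) (hcov : u ≤ T ∨ ∃ t ≤ T, p.1 t ∈ F) :
    CurveClass.stopAt F (Driver.headClass p.1 u) = CurveClass.stopAt F (Driver.headClass p'.1 u) := by
  have heq := (eqOn_polyline_map_of_mem_explorationCylinder (medialPoint E.δ) hω').symm
  have htr : Loewner.trace p.2 = p.1 := Loewner.IsGeneratedByCurve.trace_eq_holds p.2.continuous hp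
  have hT' : φ'.boundaryExtension '' (Loewner.trace p.2 '' Icc 0 T) ⊆
      ((⟨polyline ((medialExploration E ω).map (medialPoint E.δ))⟩ : Curve ℂ) : I → ℂ) ''
        Iic ⟨1 - (1 / 2) ^ (n + 1), one_sub_half_pow_mem_unitInterval _⟩ := by
    rw [htr]
    refine hT.trans (le_of_eq ?_)
    exact (image_Iic_polyline_map_eq_range_prefix (medialPoint E.δ) n ω).symm
  have hWW' : EqOn p.2 p'.2 (Icc 0 T) := hd.eqOn_of_eqOn hφ' hd' heq hT'
  exact stopAt_headClass_eq_of_eqOn hu hF (fst_eqOn_of_snd_eqOn hp hp' hWW') hcov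

end Head

/-- **Registered form** (anchor `head_isLoewnerDescribed_of_drivingFunction_eq` of stmt-CriticalPhenomena-0746, input (T2) of
`Driver.PercFaceAnnulusTransfer`): the Loewner pair handed over by box tightness describes the interface.
[cite: KemppainenSmirnov2017, §1.2] -/
theorem head_isLoewnerDescribed_of_drivingFunction_eq : ∀ {D : Literature.Probability.RandomPlanarGeometry.DobrushinDomain} {φ : Literature.Probability.RandomPlanarGeometry.ConformalEquiv UpperHalfPlane.upperHalfPlaneSet D.carrier}, D.IsChordalUniformizing φ → ∀ {p : ContinuousMap NNReal ℂ × ContinuousMap NNReal ℝ}, p ∈ Literature.Probability.RandomPlanarGeometry.generatedPairs → ∀ {Y : Literature.Probability.RandomPlanarGeometry.CurveClass ℂ}, Y = Literature.Probability.RandomPlanarGeometry.compactifiedClass φ.boundaryExtension (D.pt 1) p.1 → Literature.Probability.RandomPlanarGeometry.drivingFunction φ Y = p.2 → Literature.Probability.RandomPlanarGeometry.IsLoewnerDescribed φ Y p.2 :=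
  fun hφ _ hp _ hY hW ↦ Head.isLoewnerDescribed_of_drivingFunction_eq hφ hp hY hW

/-- **Registered form** (anchor `head_stopAt_headClass_eq_of_mem_explorationCylinder` of stmt-CriticalPhenomena-0746, input (T2)
of `Driver.PercFaceAnnulusTransfer`): on a prefix event, below a covering capacity time, the stopped capacity-`u` heads of the
Loewner pairs describing the two exploration polylines coincide. [cite: KemppainenSmirnov2017, §4.2] -/
theorem head_stopAt_headClass_eq_of_mem_explorationCylinder : ∀ {E : Literature.Probability.LatticeModels.DiscreteDobrushin} {hE : E.IsZdAdmissible} {D' : Literature.Probability.RandomPlanarGeometry.DobrushinDomain} {φ' : Literature.Probability.RandomPlanarGeometry.ConformalEquiv UpperHalfPlane.upperHalfPlaneSet D'.carrier}, D'.IsChordalUniformizing φ' → ∀ {ω ω' : Literature.Probability.Percolation.BondConfig (Literature.Probability.LatticeModels.Site 2)} {n : ℕ}, ω' ∈ Literature.Probability.LatticeModels.DiscreteDobrushin.explorationCylinder hE ω n → ∀ {p p' : ContinuousMap NNReal ℂ × ContinuousMap NNReal ℝ}, p ∈ Literature.Probability.RandomPlanarGeometry.generatedPairs → p' ∈ Literature.Probability.RandomPlanarGeometry.generatedPairs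 → Literature.Probability.RandomPlanarGeometry.IsLoewnerDescribed φ' (Literature.Probability.RandomPlanarGeometry.CurveClass.mk ⟨Literature.Probability.LatticeModels.polyline ((Literature.Probability.LatticeModels.medialExploration E ω).map (Literature.Probability.LatticeModels.medialPoint E.δ))⟩) p.2 → Literature.Probability.RandomPlanarGeometry.IsLoewnerDescribed φ' (Literature.Probability.RandomPlanarGeometry.CurveClass.mk ⟨Literature.Probability.LatticeModels.polyline ((Literature.Probability.LatticeModels.medialExploration E ω').map (Literature.Probability.LatticeModels.medialPoint E.δ))⟩) p'.2 → ∀ {T : NNReal}, φ'.boundaryExtension '' (p.1 '' Set.Icc 0 T) ⊆ Set.range (Literature.Probability.LatticeModels.polyline ((Literature.Probability.LatticeModels.DiscreteDobrushin.explorationPrefix E n ω).map (Literature.Probability.LatticeModels.medialPoint E.δ))) → ∀ {u : NNReal}, 0 < u → ∀ {F : Set ℂ}, IsClosed F → (u ≤ T ∨ ∃ t ≤ T, p.1 t ∈ F) → Literature.Probability.RandomPlanarGeometry.CurveClass.stopAt F (Driver.headClass p.1 u) = Literature.Probability.RandomPlanarGeometry.CurveClass.stopAt F (Driver.headClass p'.1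 u) :=
  fun hφ' _ _ _ hω' _ _ hp hp' hd hd' _ hT _ hu _ hF hcov ↦
    Head.stopAt_headClass_eq_of_mem_explorationCylinder hφ' hω' hp hp' hd hd' hT hu hF hcov

end Summit.CriticalPhenomena.CardyFormulaZ2.Cruxes.CardyRigidity.CrossingMartingale

end
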